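import Summits.HodgeConjecture.CorCM.MumfordTateRankCMCurveTimesCMThreefold
import Summits.HodgeConjecture.CorCM.CMEllipticCurveTimesSimpleCMThreefold
import Summits.HodgeConjecture.CorCM.MumfordTateRankCMCurvesSurfacesProducts
import Summits.HodgeConjecture.CorCM.MumfordTateRankDuplicateFactor
import Literature.AlgebraicGeometry.Pohlmann1968.CMFamilyRankSubfamilies
import HarnessLib

/-!
# Simple CM abelian THREEFOLD × two non-isogenous CM elliptic curves: `t = 6` iff neither curve field maps to `K = End⁰T`, `t = 5` if one
# does — the CM × CM × CM cell of the fivefold partition {1,1,3} (Moonen–Zarhin 1999 Thm. (0.2) (a)/(4) with a CM threefold, two curves at once)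

COR-CM (cell `pub-hodgecm2`, seat `b27` gen 50, count-neutral Mumford–Tate-rank ladder; theorems only, no definition, no named fact;
UNCONDITIONAL — nothing here uses or asserts HC_CM).  Notation `t(X) = dim MT(H¹X)`.

Seat b16's `isNondegenerateFamily_iff_forall_isEmpty_of_finrank_le_six` (`CorCM/CMEllipticCurveTimesSimpleCMThreefold`: ANY number of pairwise
non-isogenous CM elliptic curves and ONE simple CM abelian variety on a field of degree `≤ 6` form a nondegenerate family iff NO curve field embeds
in that field) transported to ABSTRACT varieties as in `CorCM/MumfordTateRankCMCurvesSurfacesProducts` (realise each simple CM factor by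
`Pohlmann1968.exists_realisation_mtRank_eq`, carry `X ∼ ⨁ ![T, E₁, E₂]` along the isogenies, read nondegeneracy as `t(X) = 3 + 1 + 1 + 1`
by `isNondegenerateFamily_iff_mtRank_hodge_one_eq`, and read «`K_a ↪ K_b`» as «`End⁰E_a → End⁰T`» through `End⁰ ≅ K` for simple realisations);
the degenerate cell is pinned by the MONOTONICITY of the CM family rank along sub-families (`Pohlmann1968.cmFamilyRank_comp_le`:
`t(T × E_a) ≤ t(T × E₁ × E₂)`) and subadditivity.  (A sextic CM field has at most one imaginary quadratic subfield, so for non-isogenous curves at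
most one of the two fields maps to `K`; that case analysis is not needed here: the bounds `4 ≤ t ≤ 5` cover the empty cell.)

* §0 `isEmpty_ringHom_iff_of_ringEquiv` — transport of «no ring homomorphism» along ring isomorphisms.
* §1 **`mtRank_hodge_one_cmThreefold_prod_cmCurves`** — for `X ∼ T × (E₁ × E₂)`, `T` a simple CM threefold, `E₁ ≁ E₂` CM curves:
  `(t(X) = 6 ↔ End⁰E₁ ↛ End⁰T ∧ End⁰E₂ ↛ End⁰T)` ∧ `t(T × E_a) ≤ t(X)` (`a = 1, 2`) ∧ `t(X) ≤ 6`.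
* §2 the cells: **`mtRank_hodge_one_eq_six_of_…_of_isEmpty_of_isEmpty`** (`6`), **`mtRank_hodge_one_eq_five_of_…_of_isEmpty_of_nonempty`** (`5`),
  and **`mtRank_hodge_one_mem_of_isIsogenous_cmThreefold_prod_cmCurves`** — `t(T × E₁ × E₂) ∈ {4, 5, 6}` for ANY two CM curves (isogenous
  curves: duplicate factor, `t(T × E) ∈ {4, 5}`).

## References
* [MoonenZarhin1999LowDim] B. Moonen, Yu. G. Zarhin, *Hodge classes on abelian varieties of low dimension*, Math. Ann. 315 (1999), Thm. (0.2) (a), (4),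
  §3 (3.1), Prop. (3.8) [corpus: paper:arxiv-math_9901113 pp. 1–2, 6–7]. [cite: MoonenZarhin1999LowDim, Thm. (0.2) and §3 Prop. (3.8)]
* [Gordon1999HodgeAVSurvey] B. B. Gordon, *A survey of the Hodge conjecture for abelian varieties*, §3 Theorem (1), 7.4–7.7, 9.1.
  [cite: Gordon1999HodgeAVSurvey, 7.5 and 9.1]
* [Shimura1998] G. Shimura, *Abelian Varieties with Complex Multiplication and Modular Functions*, §5.1 Prop. 6, §8.2 Prop. 26.
  [cite: Shimura1998, §5.1 Prop. 6]
-/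

noncomputable section

open CategoryTheory CategoryTheory.Limits NumberField Module IntermediateField
open scoped BigOperators

namespace Summit.HodgeConjecture.CorCM

open Literature.NumberTheory.ComplexMultiplication
open Literature.AlgebraicGeometry.Motives
open Literature.AlgebraicGeometry.Motives.AbelianVariety
open Literature.AlgebraicGeometry.HodgeTheory
open Literature.AlgebraicGeometry.ComplexMultiplication
open Literature.AlgebraicGeometry.Milne1999 (IsOfCMType isOfCMType_iff_of_isIsogenous isIsogeny_biproduct_map)
open Literature.AlgebraicGeometry.Pohlmann1968
open Summit.HodgeConjecture.HodgeConjecture.Ring2.Atlas (nonempty_ringEquiv_endAlgebra_of_isSimple)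

variable [HodgeTensorFacts.{0, 0}] {X T E₁ E₂ : AbelianVariety ℂ} {n : ℕ}

/-! ## §0 Transport of «no ring homomorphism» -/

omit [HodgeTensorFacts.{0, 0}] in
/-- `IsEmpty (R →+* S)` is invariant under ring isomorphisms of `R` and of `S`. [folklore] -/
theorem isEmpty_ringHom_iff_of_ringEquiv {R R' S S' : Type*} [NonAssocSemiring R] [NonAssocSemiring R'] [NonAssocSemiring S]
    [NonAssocSemiring S'] (eR : R ≃+* R') (eS : S ≃+* S') : IsEmpty (R →+* S) ↔ IsEmpty (R' →+* S') := by
  constructor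
  · intro h
    exact ⟨fun f => h.false (eS.symm.toRingHom.comp (f.comp eR.toRingHom))⟩
  · intro h
    exact ⟨fun f => h.false (eS.toRingHom.comp (f.comp eR.symm.toRingHom))⟩

/-! ## §1 The realisation transport: nondegeneracy criterion, monotonicity, Kubota's bound -/

/-- **Simple CM threefold × two non-isogenous CM curves — the three readings.**  For `T` a simple abelian threefold of CM type, `E₁ ≁ E₂` CM elliptic
curves and `X ∼ T × (E₁ × E₂)`: (1) `t(X) = 6` iff there is NO ring homomorphism `End⁰E₁ → End⁰T` and NONE `End⁰E₂ → End⁰T` (b16's criterion for the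
family `(Φ_T, Φ_{E₁}, Φ_{E₂})`, nondegeneracy read as `t = Σ dim + 1`); (2) `t(T × E₁) ≤ t(X)` and `t(T × E₂) ≤ t(X)` (the family rank is monotone
along sub-families); (3) `t(X) ≤ 6` (Kubota–Ribet bound). [cite: MoonenZarhin1999LowDim, Thm. (0.2) and §3 Prop. (3.8)] [cite: Gordon1999HodgeAVSurvey, 7.5 and 9.1]
[cite: Shimura1998, §5.1 Prop. 6] -/
theorem mtRank_hodge_one_cmThreefold_prod_cmCurves (hX : IsSmoothProjective n X.X) (hTs : T.IsSimple) (hT3 : T.dim = 3) (hTcm : IsOfCMType T)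
    (hE₁1 : E₁.dim = 1) (hE₁cm : IsOfCMType E₁) (hE₂1 : E₂.dim = 1) (hE₂cm : IsOfCMType E₂) (h12 : ¬ IsIsogenous E₁ E₂)
    {Y₁ Y₂ : AbelianVariety ℂ} {m₁ m₂ : ℕ} (hY₁ : IsSmoothProjective m₁ Y₁.X) (hY₂ : IsSmoothProjective m₂ Y₂.X)
    (hY₁P : IsIsogenous Y₁ (T.prod E₁)) (hY₂P : IsIsogenous Y₂ (T.prod E₂)) (hXP : IsIsogenous X (T.prod (E₁.prod E₂))) :
    haveI := BettiUniverse.finite hX 1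
    haveI := BettiUniverse.finite hY₁ 1
    haveI := BettiUniverse.finite hY₂ 1
    ((BettiUniverse.hodge exists_isReal_hodgeModel_holds hX 1).mtRank = 6 ↔
        IsEmpty (E₁.endAlgebra →+* T.endAlgebra) ∧ IsEmpty (E₂.endAlgebra →+* T.endAlgebra)) ∧
      (BettiUniverse.hodge exists_isReal_hodgeModel_holds hY₁ 1).mtRank ≤ (BettiUniverse.hodge exists_isReal_hodgeModel_holds hX 1).mtRank ∧
      (BettiUniverse.hodge exists_isReal_hodgeModel_holds hY₂ 1).mtRank ≤ (BettiUniverse.hodge exists_isReal_hodgeModel_holds hX 1).mtRank ∧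
      (BettiUniverse.hodge exists_isReal_hodgeModel_holds hX 1).mtRank ≤ 6 := by
  classical
  haveI := BettiUniverse.finite hX 1
  haveI := BettiUniverse.finite hY₁ 1
  haveI := BettiUniverse.finite hY₂ 1
  let F : Fin 3 → AbelianVariety ℂ := ![T, E₁, E₂]
  have hF0 : F 0 = T := rfl
  have hF1 : F 1 = E₁ := rfl
  have hF2 : F 2 = E₂ := rfl
  have hdimF : ∀ i, (F i).dim = if i = 0 then 3 else 1 := fun i => by
    fin_cases i
    · simpa [hF0] using hT3
    · simpa [hF1] using hE₁1
    · simpa [hF2] using hE₂1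
  have hFs : ∀ i, (F i).IsSimple := fun i => by
    fin_cases i
    · exact hTs
    · exact isSimple_of_dim_le_one (A := E₁) hE₁1.le
    · exact isSimple_of_dim_le_one (A := E₂) hE₂1.le
  have hFcm : ∀ i, IsOfCMType (F i) := fun i => by
    fin_cases i
    · exact hTcm
    · exact hE₁cm
    · exact hE₂cm
  have h0 : ∀ i, 0 < (F i).dim := fun i => by rw [hdimF i]; split_ifs <;> omega
  have hFniso : ∀ i i', i ≠ i' → ¬ IsIsogenous (F i) (F i') := by
    intro i i' hii' h
    have hd : (F i).dim = (F i').dim := dim_eq_of_isIsogenous_holds h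
    fin_cases i <;> fin_cases i'
    · exact hii' rfl
    · exact absurd hd (by simp [hdimF])
    · exact absurd hd (by simp [hdimF])
    · exact absurd hd (by simp [hdimF])
    · exact hii' rfl
    · exact h12 h
    · exact absurd hd (by simp [hdimF])
    · exact h12 h.symm'
    · exact hii' rfl
  -- realisations `F' i ∼ F i` of CM types `Φ i` on CM fields `K i` of degree `2 · dim F_i`, primitive
  have hreal := fun i => exists_realisation_mtRank_eq (AbelianVariety.isSmoothProjective_holds (A := F i)) (hFs i) (h0 i) (hFcm i)
  choose K fK nfK cmK Φ F' ι θ s₀ hspec using hreal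
  have hA : ∀ i, IsCMTypeRealisation (Φ i) (F' i) (ι i) (θ i) := fun i => (hspec i).1
  have hiso : ∀ i, IsIsogenous (F i) (F' i) := fun i => (hspec i).2.1
  have hdeg : ∀ i, Module.finrank ℚ (K i) = 2 * (F i).dim := fun i => (hspec i).2.2.1
  have hprim : ∀ i, IsPrimitive (ℂ ≃+* ℂ) (Φ i).1 (s₀ i) := fun i => (hspec i).2.2.2.1
  have hdimF' : ∀ i, (F' i).dim = (F i).dim := fun i => ((dim_eq_of_isIsogenous_holds (hiso i) : (F i).dim = (F' i).dim)).symm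
  have hs : ∀ i, (F' i).IsSimple := fun i => (hFs i).of_isIsogenous (hiso i)
  have hniso' : ∀ i i', i ≠ i' → ¬ IsIsogenous (F' i) (F' i') := fun i i' hii' h =>
    hFniso i i' hii' (((hiso i).trans h).trans (hiso i').symm')
  -- `X ∼ ⨁ F'`, `Y_a ∼ ⨁ (F' ∘ π_a)` with `π_a = ![0, a]`
  choose g hg using fun j => hiso j
  have hXB : IsIsogenous X (⨁ fun j => F' (id j)) :=
    (hXP.trans (biproduct_three_isIsogenous_prod_prod F).symm').trans ⟨biproduct.map g, isIsogeny_biproduct_map hg⟩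
  have hYB : ∀ a : Fin 3, ∀ {Y : AbelianVariety ℂ}, IsIsogenous Y (T.prod (F a)) →
      IsIsogenous Y (⨁ fun j : Fin 2 => F' ((![0, a] : Fin 2 → Fin 3) j)) := by
    intro a Y hYP
    have h2 := prod_isIsogenous_biproduct_two (F' 0) (F' a)
    have hfun : (fun j : Fin 2 => F' ((![0, a] : Fin 2 → Fin 3) j)) = (fun j : Fin 2 => (![F' 0, F' a] : Fin 2 → AbelianVariety ℂ) j) := by
      funext j
      fin_cases j <;> rfl
    rw [hfun]
    exact (hYP.trans ((hiso 0).prod (hiso a))).trans h2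
  -- (1) nondegeneracy ↔ `t = Σ dim + 1 = 6`
  have hrank := isNondegenerateFamily_iff_mtRank_hodge_one_eq hA Function.surjective_id hX hXB
  have hsum : ∑ i, (F' i).dim = 5 := by
    rw [Finset.sum_congr rfl fun i _ => hdimF' i]
    simp only [Fin.sum_univ_three, hdimF]
    decide
  rw [hsum, show (5 + 1 : ℕ) = 6 from rfl] at hrank
  -- b16's criterion with `b = 0`
  have h2 : ∀ j : Fin 3, j ≠ 0 → Module.finrank ℚ (K j) = 2 := fun j hj => by
    rw [hdeg j, hdimF j, if_neg hj]
  have hsep : CMAlgebra.IsSeparatingFamily (fun j : {j : Fin 3 // j ≠ 0} => Φ j.1) :=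
    CMAlgebra.isSeparatingFamily_of_isSimple_of_pairwise_not_isIsogenous (fun j => hA j.1) (fun j => hs j.1)
      (fun j j' hjj' => hniso' j.1 j'.1 (fun h => hjj' (Subtype.ext h)))
  have h6 : Module.finrank ℚ (K 0) ≤ 6 := by rw [hdeg 0, hdimF 0, if_pos rfl]
  have hcrit := isNondegenerateFamily_iff_forall_isEmpty_of_finrank_le_six (0 : Fin 3) Φ h2 hsep h6 (s₀ 0) (hprim 0)
  -- the dictionary `K i ≃ End⁰(F' i) ≃ End⁰(F i)`
  have hKF : ∀ i, Nonempty (K i ≃+* (F i).endAlgebra) := fun i => by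
    obtain ⟨e⟩ := nonempty_ringEquiv_endAlgebra_of_isSimple (hA i) (hs i)
    obtain ⟨a⟩ := (hiso i).nonempty_endAlgebra_algEquiv
    exact ⟨e.trans a.symm.toRingEquiv⟩
  have htrans : ∀ a : Fin 3, IsEmpty (K a →+* K 0) ↔ IsEmpty ((F a).endAlgebra →+* T.endAlgebra) := fun a =>
    isEmpty_ringHom_iff_of_ringEquiv (hKF a).some (hKF 0).some
  refine ⟨?_, ?_, ?_, ?_⟩
  · -- (1)
    rw [← hrank, hcrit]
    constructor
    · intro h
      exact ⟨(htrans 1).1 (h 1 (by decide)), (htrans 2).1 (h 2 (by decide))⟩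
    · rintro ⟨h₁, h₂⟩ a ha
      fin_cases a
      · exact absurd rfl ha
      · exact (htrans 1).2 h₁
      · exact (htrans 2).2 h₂
  · -- (2) `t(T × E₁) ≤ t(X)`
    rw [mtRank_hodge_one_eq_cmFamilyRank_of_isIsogenous_biproduct (A' := fun j => F' ((![0, 1] : Fin 2 → Fin 3) j)) (cls := id)
        (Φ' := fun j => Φ ((![0, 1] : Fin 2 → Fin 3) j)) (fun j => hA ((![0, 1] : Fin 2 → Fin 3) j)) Function.surjective_id hY₁ (hYB 1 hY₁P),
      mtRank_hodge_one_eq_cmFamilyRank_of_isIsogenous_biproduct (A' := F') (cls := id) hA Function.surjective_id hX hXB]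
    exact CMAlgebra.cmFamilyRank_comp_le Φ _
  · -- (2) `t(T × E₂) ≤ t(X)`
    rw [mtRank_hodge_one_eq_cmFamilyRank_of_isIsogenous_biproduct (A' := fun j => F' ((![0, 2] : Fin 2 → Fin 3) j)) (cls := id)
        (Φ' := fun j => Φ ((![0, 2] : Fin 2 → Fin 3) j)) (fun j => hA ((![0, 2] : Fin 2 → Fin 3) j)) Function.surjective_id hY₂ (hYB 2 hY₂P),
      mtRank_hodge_one_eq_cmFamilyRank_of_isIsogenous_biproduct (A' := F') (cls := id) hA Function.surjective_id hX hXB]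
    exact CMAlgebra.cmFamilyRank_comp_le Φ _
  · -- (3) Kubota's bound
    haveI : Nonempty (Fin 3) := ⟨0⟩
    have h := mtRank_hodge_one_le_sum_dim_add_one_of_isIsogenous_biproduct hA Function.surjective_id hX hXB
    rw [hsum] at h
    exact h

/-! ## §2 The cells -/

/-- **`t(T × E₁ × E₂) = 6` when neither curve field maps to `End⁰T`** (`T` a simple CM threefold, `E₁`, `E₂` CM curves with no ring homomorphisms
`End⁰E₁ → End⁰T`, `End⁰E₂ → End⁰T`, and `E₁ ≁ E₂`): `Hg(T × E₁ × E₂) = U_K × U_{k₁} × U_{k₂}` of rank `5`, Moonen–Zarhin (0.2)(4) for two curves.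
[cite: MoonenZarhin1999LowDim, Thm. (0.2) and §3 Prop. (3.8)] [cite: Gordon1999HodgeAVSurvey, 7.5 and 9.1] -/
theorem mtRank_hodge_one_eq_six_of_isIsogenous_cmThreefold_prod_cmCurves_of_isEmpty_of_isEmpty (hX : IsSmoothProjective n X.X)
    (hTs : T.IsSimple) (hT3 : T.dim = 3) (hTcm : IsOfCMType T) (hE₁1 : E₁.dim = 1) (hE₁cm : IsOfCMType E₁) (hE₂1 : E₂.dim = 1)
    (hE₂cm : IsOfCMType E₂) (h12 : ¬ IsIsogenous E₁ E₂) (hf₁ : IsEmpty (E₁.endAlgebra →+* T.endAlgebra))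
    (hf₂ : IsEmpty (E₂.endAlgebra →+* T.endAlgebra)) (hXP : IsIsogenous X (T.prod (E₁.prod E₂))) :
    haveI := BettiUniverse.finite hX 1
    (BettiUniverse.hodge exists_isReal_hodgeModel_holds hX 1).mtRank = 6 :=
  (mtRank_hodge_one_cmThreefold_prod_cmCurves hX hTs hT3 hTcm hE₁1 hE₁cm hE₂1 hE₂cm h12 (AbelianVariety.isSmoothProjective_holds (A := T.prod E₁))
    (AbelianVariety.isSmoothProjective_holds (A := T.prod E₂)) (IsIsogenous.refl _) (IsIsogenous.refl _) hXP).1.2 ⟨hf₁, hf₂⟩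

/-- **`t(T × E₁ × E₂) = 5` when exactly the second curve field maps to `End⁰T`** (`T` a simple CM threefold, `E₁`, `E₂` CM curves, no ring homomorphism
`End⁰E₁ → End⁰T`, some `End⁰E₂ → End⁰T`): `5 = t(T × E₁) ≤ t(X) ≤ t(E₂ × T) + t(E₁) − 1 = 4 + 1` (monotonicity of the family rank; subadditivity).
The curves are automatically non-isogenous (isogenous curves have isomorphic `End⁰`). [cite: MoonenZarhin1999LowDim, Thm. (0.2) and §3 Prop. (3.8)]
[cite: Gordon1999HodgeAVSurvey, 7.5 and 9.1] -/
theorem mtRank_hodge_one_eq_five_of_isIsogenous_cmThreefold_prod_cmCurves_of_isEmpty_of_nonempty (hX : IsSmoothProjective n X.X)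
    (hTs : T.IsSimple) (hT3 : T.dim = 3) (hTcm : IsOfCMType T) (hE₁1 : E₁.dim = 1) (hE₁cm : IsOfCMType E₁) (hE₂1 : E₂.dim = 1)
    (hE₂cm : IsOfCMType E₂) (hf₁ : IsEmpty (E₁.endAlgebra →+* T.endAlgebra)) (hf₂ : Nonempty (E₂.endAlgebra →+* T.endAlgebra))
    (hXP : IsIsogenous X (T.prod (E₁.prod E₂))) :
    haveI := BettiUniverse.finite hX 1
    (BettiUniverse.hodge exists_isReal_hodgeModel_holds hX 1).mtRank = 5 := by
  haveI := BettiUniverse.finite hX 1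
  -- `E₁ ≁ E₂`
  have h12 : ¬ IsIsogenous E₁ E₂ := fun h => by
    obtain ⟨a⟩ := h.nonempty_endAlgebra_algEquiv
    obtain ⟨f⟩ := hf₂
    exact hf₁.false (f.comp a.toRingEquiv.toRingHom)
  have hY₁ : IsSmoothProjective (T.prod E₁).dim (T.prod E₁).X := AbelianVariety.isSmoothProjective_holds
  have hY₂ : IsSmoothProjective (E₂.prod T).dim (E₂.prod T).X := AbelianVariety.isSmoothProjective_holds
  have hE₁ : IsSmoothProjective E₁.dim E₁.X := AbelianVariety.isSmoothProjective_holds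
  haveI := BettiUniverse.finite hY₁ 1
  haveI := BettiUniverse.finite hY₂ 1
  haveI := BettiUniverse.finite hE₁ 1
  obtain ⟨-, hmono, -, -⟩ := mtRank_hodge_one_cmThreefold_prod_cmCurves hX hTs hT3 hTcm hE₁1 hE₁cm hE₂1 hE₂cm h12 hY₁
    (AbelianVariety.isSmoothProjective_holds (A := T.prod E₂)) (IsIsogenous.refl _) (IsIsogenous.refl _) hXP
  -- `t(T × E₁) = 5`
  have h5 := (mtRank_hodge_one_eq_five_iff_isEmpty_ringHom_of_isIsogenous_cmCurve_prod_isSimple_cmThreefold hY₁ hE₁1 hE₁cm hTs hT3 hTcm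
    (isIsogenous_prod_comm T E₁)).2 hf₁
  -- `t(E₂ × T) = 4`, `t(E₁) = 2`, subadditivity over `X ∼ (E₂ × T) × E₁`
  have h4 := (mtRank_hodge_one_eq_four_iff_nonempty_ringHom_of_isIsogenous_cmCurve_prod_isSimple_cmThreefold hY₂ hE₂1 hE₂cm hTs hT3 hTcm
    (IsIsogenous.refl _)).2 hf₂
  have h2 := mtRank_hodge_one_eq_two_of_cm_curve hE₁1 hE₁cm
  have hXQ : IsIsogenous X ((E₂.prod T).prod E₁) :=
    (hXP.trans ((IsIsogenous.refl T).prod (isIsogenous_prod_comm E₁ E₂))).trans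
      ((Literature.AlgebraicGeometry.HodgeTheory.isIsogenous_prod_assoc T E₂ E₁).symm'.trans
        ((isIsogenous_prod_comm T E₂).prod (IsIsogenous.refl E₁)))
  have hle := mtRank_hodge_one_add_one_le_add_of_isIsogenous_prod hY₂ hE₁ (by rw [dim_prod]; omega) (by omega) hX hXQ
  omega

/-- **Simple CM threefold × ANY two CM elliptic curves: `t(T × E₁ × E₂) ∈ {4, 5, 6}`** — `6` iff the curves are non-isogenous and neither field maps to
`End⁰T`; `4` iff both curves' fields map to `End⁰T` (then `E₁ ∼ E₂`); `5` otherwise.  (Isogenous curves: duplicate factor and `t(T × E) ∈ {4, 5}`; a field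
mapping to `End⁰T`: `t ≤ t(E × T) + 2 − 1 = 5` and `t ≥ t(T × E) = 4`.) [cite: MoonenZarhin1999LowDim, Thm. (0.2) and §3 Prop. (3.8)]
[cite: Gordon1999HodgeAVSurvey, 7.5 and 9.1] -/
theorem mtRank_hodge_one_mem_of_isIsogenous_cmThreefold_prod_cmCurves (hX : IsSmoothProjective n X.X) (hTs : T.IsSimple) (hT3 : T.dim = 3)
    (hTcm : IsOfCMType T) (hE₁1 : E₁.dim = 1) (hE₁cm : IsOfCMType E₁) (hE₂1 : E₂.dim = 1) (hE₂cm : IsOfCMType E₂)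
    (hXP : IsIsogenous X (T.prod (E₁.prod E₂))) :
    haveI := BettiUniverse.finite hX 1
    (BettiUniverse.hodge exists_isReal_hodgeModel_holds hX 1).mtRank ∈ ({4, 5, 6} : Finset ℕ) := by
  classical
  haveI := BettiUniverse.finite hX 1
  simp only [Finset.mem_insert, Finset.mem_singleton]
  by_cases h12 : IsIsogenous E₁ E₂
  · -- duplicate factor: `t(X) = t(T × E₁) ∈ {4, 5}`
    have hY : IsSmoothProjective (T.prod E₁).dim (T.prod E₁).X := AbelianVariety.isSmoothProjective_holds
    haveI := BettiUniverse.finite hY 1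
    have hXQ : IsIsogenous X ((T.prod E₁).prod E₁) :=
      (hXP.trans ((IsIsogenous.refl T).prod ((IsIsogenous.refl E₁).prod h12.symm'))).trans
        (Literature.AlgebraicGeometry.HodgeTheory.isIsogenous_prod_assoc T E₁ E₁).symm'
    have hdup := mtRank_hodge_one_eq_of_isIsogenous_prod_prod_self hX hY (by rw [dim_prod]; omega) hXQ (IsIsogenous.refl _)
    rcases mtRank_hodge_one_mem_of_isIsogenous_cmCurve_prod_isSimple_cmThreefold hY hE₁1 hE₁cm hTs hT3 hTcm (isIsogenous_prod_comm T E₁) with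
      h | h <;> omega
  · have hY₁ : IsSmoothProjective (T.prod E₁).dim (T.prod E₁).X := AbelianVariety.isSmoothProjective_holds
    have hY₂ : IsSmoothProjective (T.prod E₂).dim (T.prod E₂).X := AbelianVariety.isSmoothProjective_holds
    haveI := BettiUniverse.finite hY₁ 1
    haveI := BettiUniverse.finite hY₂ 1
    obtain ⟨-, hmono₁, -, hle6⟩ := mtRank_hodge_one_cmThreefold_prod_cmCurves hX hTs hT3 hTcm hE₁1 hE₁cm hE₂1 hE₂cm h12 hY₁ hY₂
      (IsIsogenous.refl _) (IsIsogenous.refl _) hXP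
    rcases mtRank_hodge_one_mem_of_isIsogenous_cmCurve_prod_isSimple_cmThreefold hY₁ hE₁1 hE₁cm hTs hT3 hTcm (isIsogenous_prod_comm T E₁) with
      h | h <;> omega

end Summit.HodgeConjecture.CorCM

end
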